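import Summits.MatrixMultiplication.MatrixMultiplication.Theorems.SoloInformedTwistedMatchingsWeighted
import HarnessLib

/-!
# Twisted matchings in abelian `p`-groups of bounded exponent

Solo-informed seat (MatrixMultiplication), gen 101; sequel of `SoloInformedTwistedMatchingsWeighted`.
For `S = ∏_i ℤ/p^{e_i}` the elements `p^s e_i` (`s < e_i`, level `s`) form a `p`-central generating
system (monomial basis = the Jennings basis `∏ (x_i - 1)^{a_i}` of `K[S]`); the generators of level
`≥ s` generate `p^s S`, a fully invariant subgroup, so EVERY endomorphism respects the levels
(`exists_prodZMod_levelPCGS`). Hence `exists_abelianTwistedMatching_card_le`: for every prime `p`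
and every `E` there is `δ > 0` such that in every finite abelian group `S` with `g^{p^E} = 1` a family
`(x_i, y_i, z_i)_{i ∈ ι}` with `(∃ s, x_i φ_s(y_j) ψ_s(z_l) = 1) ⟺ i = j = l`, `(φ_s, ψ_s)` finitely
many automorphism pairs, has `|ι| ≤ 3 |S|^{1-δ}`; and
`realization_abelianTwisted_inducedMatching_card_le`: a Cohn–Umans realization of `⟨n,n,n⟩` in a
translation scheme `𝒮(S, M₀)` (`M₀ ≤ Aut S` arbitrary) bounds every induced matching of the support
of `⟨n,n,n⟩` by `3 |S|^{1-δ}` — the bounded-exponent form of the seat's Theorem B″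
(sharpest-statement §2y(8)). References: BlasiakChurchCohnGrochowUmans2017 (arXiv:1712.02302)
Def. 3.5, Prop. 3.10, Thm. 3.11; CohnUmans2013 (arXiv:1207.6528) Def. 12, §5, Conj. 21;
S. A. Jennings, Trans. AMS 50 (1941).
-/

noncomputable section

open scoped BigOperators
open Finset Literature.Combinatorics.Additive Literature.Barriers.MatrixMultiplication

namespace Summit.MatrixMultiplication.MatrixMultiplication.Theorems.TwistedSliceRank

section ProdZMod

/-- Base-`p` digits: `Σ_{s<m} (v / p^s mod p) p^s = v mod p^m`. [folklore] -/
theorem digit_sum {p : ℕ} (hp : 0 < p) (v : ℕ) :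
    ∀ m : ℕ, ∑ s ∈ range m, v / p ^ s % p * p ^ s = v % p ^ m := by
  intro m
  induction m with
  | zero => simp [Nat.mod_one]
  | succ m ih =>
    rw [Finset.sum_range_succ, ih]
    set P := p ^ m with hP
    have hP0 : 0 < P := by positivity
    obtain ⟨q, r, hr, hv⟩ : ∃ q r, r < P ∧ v = P * q + r :=
      ⟨v / P, v % P, Nat.mod_lt _ hP0, (Nat.div_add_mod v P).symm⟩
    obtain ⟨q', d, hd, hq⟩ : ∃ q' d, d < p ∧ q = p * q' + d :=
      ⟨q / p, q % p, Nat.mod_lt _ hp, (Nat.div_add_mod q p).symm⟩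
    have h1 : v % P = r := by rw [hv, Nat.mul_add_mod]; exact Nat.mod_eq_of_lt hr
    have h2 : v / P = q := by rw [hv, Nat.mul_add_div hP0, Nat.div_eq_of_lt hr, add_zero]
    have h3 : q % p = d := by rw [hq, Nat.mul_add_mod]; exact Nat.mod_eq_of_lt hd
    have h4 : v = (r + d * P) + (p * P) * q' := by rw [hv, hq]; ring
    have h5 : r + d * P < p * P :=
      calc r + d * P < (d + 1) * P := by rw [add_mul, one_mul, add_comm]; omega
        _ ≤ p * P := Nat.mul_le_mul_right _ hd
    rw [h1, h2, h3, pow_succ', h4, Nat.add_mul_mod_self_left, Nat.mod_eq_of_lt h5]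

/-- In a commutative group the ordered product is the product. [folklore] -/
theorem orderedProd_eq_prod {S : Type*} [CommGroup S] {ι : Type*} [LinearOrder ι] [Fintype ι]
    (gen : ι → S) (ex : ι → ℕ) : orderedProd gen ex = ∏ a, gen a ^ ex a := by
  rw [orderedProd, ← List.prod_toFinset _ (Finset.sort_nodup _ _), Finset.sort_toFinset]

variable {κ : Type} [Fintype κ] [DecidableEq κ] {p : ℕ} {n e : κ → ℕ} [∀ i, NeZero (n i)]

omit [Fintype κ] in
/-- `(mulSingle j v)^{p^s} = (mulSingle j (p^s))^{val v}`. [folklore] -/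
theorem mulSingle_pow_pow (j : κ) (v : ZMod (n j)) (s : ℕ) :
    (Pi.mulSingle j (Multiplicative.ofAdd v) : (i : κ) → Multiplicative (ZMod (n i))) ^ p ^ s =
      Pi.mulSingle j (Multiplicative.ofAdd ((p ^ s : ℕ) : ZMod (n j))) ^ v.val := by
  rw [← Pi.mulSingle_pow, ← Pi.mulSingle_pow, ← ofAdd_nsmul, ← ofAdd_nsmul, nsmul_eq_mul,
    nsmul_eq_mul, ZMod.natCast_zmod_val, mul_comm]

omit [Fintype κ] [∀ i, NeZero (n i)] in
/-- `mulSingle j (p^s) = 1` once `n_j = p^{e_j}` divides `p^s`. [folklore] -/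
theorem mulSingle_ppow_eq_one (hn : ∀ i, n i = p ^ e i) (j : κ) {s : ℕ} (hs : e j ≤ s) :
    (Pi.mulSingle j (Multiplicative.ofAdd ((p ^ s : ℕ) : ZMod (n j))) :
      (i : κ) → Multiplicative (ZMod (n i))) = 1 := by
  have h0 : ((p ^ s : ℕ) : ZMod (n j)) = 0 :=
    (ZMod.natCast_eq_zero_iff _ _).2 (hn j ▸ pow_dvd_pow p hs)
  rw [h0, ofAdd_zero, Pi.mulSingle_one]

/-- **An explicit `p`-central generating system for `∏_i ℤ/p^{e_i}`**: generators `p^s e_i`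
(`s < e_i`) of level `s`, trivial commutators, `(p^s e_i)^p = p^{s+1} e_i`, normal forms = base-`p`
digits. [this work] -/
theorem exists_prodZMod_pcgs [hp : Fact p.Prime] (hn : ∀ i, n i = p ^ e i) {E : ℕ} (hE : ∀ i, e i ≤ E)
    [lo : LinearOrder ((i : κ) × Fin (e i))]
    (hmono : ∀ a b : (i : κ) × Fin (e i), lo.le a b → (a.2 : ℕ) ≤ b.2) :
    ∃ C : PCGS p ((i : κ) → Multiplicative (ZMod (n i))) ((i : κ) × Fin (e i)),
      (∀ a, C.gen a = Pi.mulSingle a.1 (Multiplicative.ofAdd ((p ^ (a.2 : ℕ) : ℕ) : ZMod (n a.1)))) ∧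
      (∀ a, C.lvl a = a.2) ∧ C.L = E := by
  have hp0 : 0 < p := hp.out.pos
  have hp2 : 2 ≤ p := hp.out.two_le
  -- the generators
  let gen : ((i : κ) × Fin (e i)) → ((i : κ) → Multiplicative (ZMod (n i))) :=
    fun a => Pi.mulSingle a.1 (Multiplicative.ofAdd ((p ^ (a.2 : ℕ) : ℕ) : ZMod (n a.1)))
  -- powers
  have hpow : ∀ a : (i : κ) × Fin (e i), gen a ^ p =
      Pi.mulSingle a.1 (Multiplicative.ofAdd ((p ^ ((a.2 : ℕ) + 1) : ℕ) : ZMod (n a.1))) := by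
    intro a
    simp only [gen]
    rw [← Pi.mulSingle_pow, ← ofAdd_nsmul, nsmul_eq_mul, ← Nat.cast_mul, ← pow_succ']
  refine ⟨{ L := E
            lvl := fun a => a.2
            gen := gen
            commExp := fun _ _ _ => 0
            powExp := fun a c => if c.1 = a.1 ∧ (c.2 : ℕ) = a.2 + 1 then 1 else 0
            lvl_lt := fun a => lt_of_lt_of_le a.2.isLt (hE a.1)
            lvl_mono := fun a b h => hmono a b h
            commExp_lt := fun _ _ _ => hp0
            commExp_lvl := fun _ _ _ h => (h rfl).elim
            commExp_prod := ?_
            powExp_lt := ?_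
            powExp_lvl := ?_
            powExp_prod := ?_
            exists_exp := ?_
            card_eq := ?_ }, fun a => rfl, fun a => rfl, rfl⟩
  · -- commutators are trivial
    intro a b
    rw [commutatorElement_eq_one_iff_commute.2 (Commute.all _ _), orderedProd_eq_prod]
    simp
  · intro a c
    split_ifs <;> omega
  · intro a c h
    by_cases hc : c.1 = a.1 ∧ (c.2 : ℕ) = a.2 + 1
    · show (a.2 : ℕ) < c.2
      omega
    · rw [if_neg hc] at h
      exact (h rfl).elim
  · -- `gen(a)^p = gen(successor)` or `1`
    intro a
    rw [orderedProd_eq_prod, hpow a]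
    have hite : ∀ c : (i : κ) × Fin (e i),
        gen c ^ (if c.1 = a.1 ∧ (c.2 : ℕ) = a.2 + 1 then 1 else 0) =
          if c.1 = a.1 ∧ (c.2 : ℕ) = a.2 + 1 then gen c else 1 := fun c => by
      split_ifs <;> simp
    simp_rw [hite]
    by_cases hs : (a.2 : ℕ) + 1 < e a.1
    · let c₀ : (i : κ) × Fin (e i) := ⟨a.1, ⟨(a.2 : ℕ) + 1, hs⟩⟩
      have hcond : ∀ c : (i : κ) × Fin (e i), (c.1 = a.1 ∧ (c.2 : ℕ) = a.2 + 1) ↔ c = c₀ := by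
        rintro ⟨i, s⟩
        constructor
        · rintro ⟨h1, h2⟩
          simp only at h1 h2
          subst h1
          exact Sigma.ext rfl (heq_of_eq (Fin.ext h2))
        · rintro h
          rw [h]
          exact ⟨rfl, rfl⟩
      rw [Finset.prod_eq_single c₀ (fun c _ hc => by rw [if_neg (mt (hcond c).1 hc)])
        (fun h => (h (Finset.mem_univ _)).elim), if_pos ((hcond c₀).2 rfl)]
    · rw [Finset.prod_eq_one]
      · exact mulSingle_ppow_eq_one hn a.1 (by omega)
      · rintro ⟨i, s⟩ -
        rw [if_neg]
        rintro ⟨h1, h2⟩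
        simp only at h1 h2
        subst h1
        have := s.isLt
        omega
  · -- normal forms: base-`p` digits of the coordinates
    intro g
    refine ⟨fun a => (Multiplicative.toAdd (g a.1)).val / p ^ (a.2 : ℕ) % p,
      fun a => Nat.mod_lt _ hp0, ?_⟩
    rw [orderedProd_eq_prod]
    funext j
    rw [Finset.prod_apply]
    have hoff : ∀ (i : κ) (s : Fin (e i)), i ≠ j →
        (gen ⟨i, s⟩ ^ ((Multiplicative.toAdd (g i)).val / p ^ (s : ℕ) % p)) j = 1 := by
      intro i s hij
      simp only [gen]
      rw [← Pi.mulSingle_pow, Pi.mulSingle_eq_of_ne (Ne.symm hij)]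
    have hdiag : ∀ s : Fin (e j), (gen ⟨j, s⟩ ^ ((Multiplicative.toAdd (g j)).val / p ^ (s : ℕ) % p)) j =
        Multiplicative.ofAdd
          ((((Multiplicative.toAdd (g j)).val / p ^ (s : ℕ) % p * p ^ (s : ℕ) : ℕ) : ZMod (n j))) := by
      intro s
      simp only [gen]
      rw [← Pi.mulSingle_pow, Pi.mulSingle_eq_same, ← ofAdd_nsmul, nsmul_eq_mul, ← Nat.cast_mul]
    rw [← Finset.univ_sigma_univ, Finset.prod_sigma, Finset.prod_eq_single j
      (fun i _ hij => Finset.prod_eq_one fun s _ => hoff i s hij)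
      (fun h => (h (Finset.mem_univ _)).elim), Finset.prod_congr rfl fun s _ => hdiag s]
    rw [← ofAdd_sum, ← Nat.cast_sum,
      Fin.sum_univ_eq_sum_range (fun s => (Multiplicative.toAdd (g j)).val / p ^ s % p * p ^ s)
        (e j), digit_sum hp0, Nat.mod_eq_of_lt (by rw [← hn j]; exact ZMod.val_lt _),
      ZMod.natCast_zmod_val, ofAdd_toAdd]
  · -- `|S| = p^{Σ e_i}`
    rw [Nat.card_eq_fintype_card, Fintype.card_pi, Fintype.card_sigma]
    simp only [Fintype.card_multiplicative, ZMod.card, Fintype.card_fin]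
    rw [← Finset.prod_pow_eq_pow_sum]
    exact Finset.prod_congr rfl fun i _ => hn i

/-- **Every endomorphism of `∏_i ℤ/p^{e_i}` respects the levels**: `φ(p^s e_i) ∈ p^s S`, which is
generated by the generators of level `≥ s`. [this work] -/
theorem prodZMod_gen_mem_closure (hn : ∀ i, n i = p ^ e i) {ι : Type*} [LinearOrder ι]
    [Fintype ι] (C : PCGS p ((i : κ) → Multiplicative (ZMod (n i))) ι) (idx : ι → κ)
    (lv : ι → ℕ) (hsurj : ∀ (j : κ) (s : ℕ), s < e j → ∃ b, idx b = j ∧ lv b = s)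
    (hgen : ∀ a, C.gen a =
      Pi.mulSingle (idx a) (Multiplicative.ofAdd ((p ^ lv a : ℕ) : ZMod (n (idx a)))))
    (hlvl : ∀ a, C.lvl a = lv a)
    (φ : ((i : κ) → Multiplicative (ZMod (n i))) →* ((i : κ) → Multiplicative (ZMod (n i))))
    (a : ι) : φ (C.gen a) ∈ Subgroup.closure (C.gen '' {b | C.lvl a ≤ C.lvl b}) := by
  set T := C.gen '' {b | C.lvl a ≤ C.lvl b} with hT
  set s := lv a with hs
  -- every `p^s`-th power lies in the closure
  have hpow : ∀ y : (i : κ) → Multiplicative (ZMod (n i)), y ^ p ^ s ∈ Subgroup.closure T := by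
    intro y
    rw [← Finset.univ_prod_mulSingle (y ^ p ^ s)]
    refine Subgroup.prod_mem _ fun j _ => ?_
    rw [Pi.pow_apply, ← ofAdd_toAdd (y j), Pi.mulSingle_pow, mulSingle_pow_pow]
    by_cases hsj : s < e j
    · obtain ⟨b, hbj, hbs⟩ := hsurj j s hsj
      have hmem : (Pi.mulSingle j (Multiplicative.ofAdd ((p ^ s : ℕ) : ZMod (n j))) :
          (i : κ) → Multiplicative (ZMod (n i))) ∈ T := by
        rw [hT]
        refine ⟨b, ?_, ?_⟩
        · show C.lvl a ≤ C.lvl b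
          rw [hlvl, hlvl, hbs]
        · rw [hgen b]
          subst hbj
          rw [hbs]
      exact Subgroup.pow_mem _ (Subgroup.subset_closure hmem) _
    · rw [mulSingle_ppow_eq_one hn j (not_lt.1 hsj), one_pow]
      exact Subgroup.one_mem _
  have hga : C.gen a = Pi.mulSingle (idx a) (Multiplicative.ofAdd (1 : ZMod (n (idx a)))) ^ p ^ s := by
    rw [hgen a, ← Pi.mulSingle_pow, ← ofAdd_nsmul, nsmul_eq_mul, mul_one]
  rw [hga, map_pow]
  exact hpow _

/-- **Bundled form**: `∏_i ℤ/p^{e_i}` (`e_i ≤ E`) carries a `p`-central generating system with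
`E` levels all of whose generators are mapped by EVERY endomorphism into the subgroup generated by
the generators of at least the same level (the index type is hidden). [this work] -/
theorem exists_prodZMod_levelPCGS [Fact p.Prime] (hn : ∀ i, n i = p ^ e i) {E : ℕ}
    (hE : ∀ i, e i ≤ E) :
    ∃ (ι : Type) (_ : LinearOrder ι) (_ : Fintype ι)
      (C : PCGS p ((i : κ) → Multiplicative (ZMod (n i))) ι), C.L = E ∧
      ∀ (φ : ((i : κ) → Multiplicative (ZMod (n i))) →* ((i : κ) → Multiplicative (ZMod (n i))))
        (a : ι), φ (C.gen a) ∈ Subgroup.closure (C.gen '' {b | C.lvl a ≤ C.lvl b}) := by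
  let ιA := (i : κ) × Fin (e i)
  let f : ιA → Lex (ℕ × Fin (Fintype.card κ)) :=
    fun a => toLex ((a.2 : ℕ), Fintype.equivFin κ a.1)
  have hf : Function.Injective f := by
    rintro ⟨i, s⟩ ⟨i', s'⟩ h
    have h' : ((s : ℕ), Fintype.equivFin κ i) = ((s' : ℕ), Fintype.equivFin κ i') := h
    obtain ⟨hs, hi⟩ := Prod.mk.inj h'
    have hi' := (Fintype.equivFin κ).injective hi
    subst hi'
    exact Sigma.ext rfl (heq_of_eq (Fin.ext hs))
  letI lo : LinearOrder ιA := LinearOrder.lift' f hf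
  have hmono : ∀ a b : ιA, lo.le a b → (a.2 : ℕ) ≤ b.2 := by
    intro a b h
    have h' : f a ≤ f b := h
    simp only [f, Prod.Lex.toLex_le_toLex] at h'
    rcases h' with h' | ⟨h', -⟩
    · exact h'.le
    · exact h'.le
  obtain ⟨C, hCgen, hClvl, hCL⟩ := exists_prodZMod_pcgs (p := p) (n := n) (e := e) hn hE hmono
  exact ⟨ιA, lo, inferInstance, C, hCL, prodZMod_gen_mem_closure (p := p) hn C (fun a => a.1)
    (fun a => (a.2 : ℕ)) (fun j s hs => ⟨⟨j, ⟨s, hs⟩⟩, rfl, rfl⟩) hCgen hClvl⟩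

end ProdZMod

section BoundedExponent

/-- **Twisted matchings in abelian `p`-groups of bounded exponent are polynomially small.** For
every prime `p` and every `E` there is `δ > 0` such that: for every finite abelian group `S` with
`g^{p^E} = 1` for all `g`, every finite family of pairs of automorphisms `(φ_s, ψ_s)` and every
family `(x_i, y_i, z_i)_{i ∈ ι}` in `S^3` with `(∃ s, x_i φ_s(y_j) ψ_s(z_l) = 1) ⟺ i = j = l`, one has
`|ι| ≤ 3 |S|^{1-δ}`. [this work] -/
theorem exists_abelianTwistedMatching_card_le (p : ℕ) [hp : Fact p.Prime] (E : ℕ) :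
    ∃ δ : ℝ, 0 < δ ∧ ∀ (S : Type) [CommGroup S] [Fintype S] [DecidableEq S],
      (∀ g : S, g ^ p ^ E = 1) →
      ∀ (σ : Type) [Fintype σ] (φ ψ : σ → S ≃* S) (ι : Type) [Fintype ι] (x y z : ι → S),
      (∀ i j l : ι, (∃ s : σ, x i * φ s (y j) * ψ s (z l) = 1) ↔ (i = j ∧ j = l)) →
      (Fintype.card ι : ℝ) ≤ 3 * (Fintype.card S : ℝ) ^ (1 - δ) := by
  classical
  have hp2 : 2 ≤ p := hp.out.two_le
  obtain ⟨ρ, hρ0, hρ1, hdecay⟩ :=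
    exists_tail_decay hp2 (Wmax := (p + 1) ^ (E - 1)) (Nat.one_le_pow _ _ (Nat.succ_pos p))
  have hp1 : (1 : ℝ) < p := by exact_mod_cast hp.out.one_lt
  have hlogp : 0 < Real.log p := Real.log_pos hp1
  have hlogρ : Real.log ρ < 0 := Real.log_neg hρ0 hρ1
  set δ : ℝ := -Real.log ρ / Real.log p with hδ
  have hδ0 : 0 < δ := by rw [hδ]; exact div_pos (by linarith) hlogp
  refine ⟨δ, hδ0, ?_⟩
  intro S _ _ _ hexpS σ _ φ ψ ι _ x y z hmatch
  -- structure theorem: `S ≃* ∏_i ℤ/n_i`, `n_i = p^{e_i}`, `e_i ≤ E`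
  obtain ⟨κ, _, nn, hn1, ⟨eS⟩⟩ := CommGroup.equiv_prod_multiplicative_zmod_of_finite S
  haveI : ∀ i, NeZero (nn i) := fun i => ⟨by have := hn1 i; omega⟩
  have hex : ∀ i, ∃ m ≤ E, nn i = p ^ m := by
    intro i
    refine (Nat.dvd_prime_pow hp.out).1 ((ZMod.natCast_eq_zero_iff _ _).1 ?_)
    have h1 := hexpS (eS.symm (Pi.mulSingle i (Multiplicative.ofAdd (1 : ZMod (nn i)))))
    rw [← map_pow, eS.symm.map_eq_one_iff, ← Pi.mulSingle_pow, ← ofAdd_nsmul, nsmul_eq_mul,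
      mul_one] at h1
    have h2 := congr_fun h1 i
    rw [Pi.mulSingle_eq_same, Pi.one_apply, ofAdd_eq_one] at h2
    exact h2
  choose e heE hne using hex
  obtain ⟨ιA, _, _, C, hCL, hS'⟩ := exists_prodZMod_levelPCGS (p := p) (n := nn) (e := e) hne heE
  -- transport the matching along `eS`
  let φ' := fun s => (eS.symm.trans (φ s)).trans eS
  let ψ' := fun s => (eS.symm.trans (ψ s)).trans eS
  have hrel : ∀ (i j l : ι) (s : σ),
      eS (x i) * φ' s (eS (y j)) * ψ' s (eS (z l)) = 1 ↔ x i * φ s (y j) * ψ s (z l) = 1 := by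
    intro i j l s
    simp only [φ', ψ', MulEquiv.trans_apply, MulEquiv.symm_apply_apply]
    rw [← map_mul, ← map_mul, eS.map_eq_one_iff]
  have hmatch' : ∀ i j l : ι,
      (∃ s : σ, eS (x i) * φ' s (eS (y j)) * ψ' s (eS (z l)) = 1) ↔ (i = j ∧ j = l) := by
    intro i j l
    simp_rw [hrel]
    exact hmatch i j l
  -- the field and the weights
  have hinj : Function.Injective
      (algebraMap (Polynomial (ZMod p)) (FractionRing (Polynomial (ZMod p)))) :=
    IsFractionRing.injective (Polynomial (ZMod p)) (FractionRing (Polynomial (ZMod p)))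
  haveI : CharP (FractionRing (Polynomial (ZMod p))) p := charP_of_injective_algebraMap hinj p
  haveI : Infinite (FractionRing (Polynomial (ZMod p))) := Infinite.of_injective _ hinj
  let Sol : ι → Finset σ := fun i => Finset.univ.filter fun s =>
    eS (x i) * φ' s (eS (y i)) * ψ' s (eS (z i)) = 1
  have hSol : ∀ i, (Sol i).Nonempty := fun i => by
    obtain ⟨s, hs⟩ := (hmatch' i i i).2 ⟨rfl, rfl⟩
    exact ⟨s, by simp [Sol, hs]⟩
  obtain ⟨t, ht⟩ := exists_weights (K := FractionRing (Polynomial (ZMod p))) Sol hSol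
  have hdiag : ∀ i, (∑ s, t s * (if eS (x i) * φ' s (eS (y i)) * ψ' s (eS (z i)) = 1
      then (1 : FractionRing (Polynomial (ZMod p))) else 0)) ≠ 0 := by
    intro i
    have hsum : (∑ s, t s * (if eS (x i) * φ' s (eS (y i)) * ψ' s (eS (z i)) = 1
        then (1 : FractionRing (Polynomial (ZMod p))) else 0)) = ∑ s ∈ Sol i, t s := by
      rw [Finset.sum_filter]
      exact Finset.sum_congr rfl fun s _ => by split_ifs <;> simp
    rw [hsum]
    exact ht i
  -- weights are in `[1, (p+1)^{E-1}]`
  have hW1 : ∀ a : ιA, 1 ≤ C.W a := fun a => Nat.one_le_pow _ _ (Nat.succ_pos p)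
  have hW2 : ∀ a : ιA, C.W a ≤ (p + 1) ^ (E - 1) := by
    intro a
    show (p + 1) ^ C.lvl a ≤ (p + 1) ^ (E - 1)
    have h1 := C.lvl_lt a
    rw [hCL] at h1
    exact Nat.pow_le_pow_right (Nat.succ_pos p) (by omega)
  obtain ⟨tt, hlow, hhigh⟩ := hdecay ιA C.W hW1 hW2
  have hcard := card_le_of_levelTwistedMatching C (K := FractionRing (Polynomial (ZMod p))) hS' t
    φ' ψ' (fun i => eS (x i)) (fun i => eS (y i)) (fun i => eS (z i))
    (fun i j l s h => (hmatch' i j l).1 ⟨s, h⟩) hdiag tt tt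
  have hcard' : (Fintype.card ι : ℝ) ≤
      (Fintype.card {ex : ιA → Fin p // ∑ a, (ex a : ℕ) * C.W a < tt} : ℝ) +
      (Fintype.card {ex : ιA → Fin p // ∑ a, (ex a : ℕ) * C.W a < tt} : ℝ) +
      (Fintype.card {ex : ιA → Fin p // tt + tt ≤ ∑ a, (ex a : ℕ) * C.W a} : ℝ) := by
    exact_mod_cast hcard
  -- `ρ^{|ιA|} p^{|ιA|} = |S|^{1-δ}`
  have hS : (Fintype.card S : ℝ) = (p : ℝ) ^ Fintype.card ιA := by
    rw [Fintype.card_congr eS.toEquiv, ← Nat.card_eq_fintype_card, C.card_eq]; push_cast; rfl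
  have hkey : ρ ^ Fintype.card ιA * (p : ℝ) ^ Fintype.card ιA =
      (Fintype.card S : ℝ) ^ (1 - δ) := by
    rw [hS]
    have hp0 : (0 : ℝ) < p := by linarith
    have hρp : ρ = (p : ℝ) ^ (-δ) := by
      rw [Real.rpow_def_of_pos hp0, hδ]
      have : Real.log p * -(-Real.log ρ / Real.log p) = Real.log ρ := by field_simp
      rw [this, Real.exp_log hρ0]
    rw [hρp, ← Real.rpow_natCast, ← Real.rpow_natCast, ← Real.rpow_mul hp0.le,
      ← Real.rpow_mul hp0.le, ← Real.rpow_add hp0]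
    congr 1; ring
  calc (Fintype.card ι : ℝ) ≤ _ := hcard'
    _ ≤ ρ ^ Fintype.card ιA * (p : ℝ) ^ Fintype.card ιA +
        ρ ^ Fintype.card ιA * (p : ℝ) ^ Fintype.card ιA +
        ρ ^ Fintype.card ιA * (p : ℝ) ^ Fintype.card ιA := by gcongr
    _ = 3 * (Fintype.card S : ℝ) ^ (1 - δ) := by rw [← hkey]; ring

/-- **Realizations of `⟨n,n,n⟩` in translation schemes over abelian `p`-groups of bounded
exponent have small induced matchings** — whatever the multiplier group. With the `δ > 0` of
`exists_abelianTwistedMatching_card_le`: if `S` is a finite abelian group with `g^{p^E} = 1`,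
`(φ_s, ψ_s)` a finite family of automorphism pairs and `α, β, γ : [n]² → S` realize `⟨n,n,n⟩` for
the twisted triangle predicate in the sense of Cohn–Umans 2013, Def. 12, then every induced
matching `(a_i, b_i, c_i)_{i ∈ ι}` of the support of `⟨n,n,n⟩` has `|ι| ≤ 3 |S|^{1-δ}`; since that
support has induced matchings of size `n^{2-o(1)}`, translation schemes `𝒮(S, M₀)` over abelian
`p`-groups of bounded exponent realize `⟨n,n,n⟩` only if `n^{2-o(1)} ≤ 3 |S|^{1-δ}`, uniformly in
`M₀ ≤ Aut S` (sharpest-statement §2y(8), Theorem B″, bounded-exponent form). [this work] -/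
theorem realization_abelianTwisted_inducedMatching_card_le (p : ℕ) [Fact p.Prime] (E : ℕ) :
    ∃ δ : ℝ, 0 < δ ∧ ∀ (S : Type) [CommGroup S] [Fintype S] [DecidableEq S],
      (∀ g : S, g ^ p ^ E = 1) →
      ∀ (σ : Type) [Fintype σ] (φ ψ : σ → S ≃* S) (n : ℕ) (α β γ : Fin n × Fin n → S),
      (∀ x y z : Fin n × Fin n, (∃ s : σ, α x * φ s (β y) * ψ s (γ z) = 1) ↔
          (y.1 = x.2 ∧ z = (y.2, x.1))) →
      ∀ (ι : Type) [Fintype ι] (a b c : ι → Fin n),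
        (∀ i j l : ι, b j = b i → c l = c j → a l = a i → i = j ∧ j = l) →
        (Fintype.card ι : ℝ) ≤ 3 * (Fintype.card S : ℝ) ^ (1 - δ) := by
  obtain ⟨δ, hδ0, hmain⟩ := exists_abelianTwistedMatching_card_le p E
  refine ⟨δ, hδ0, fun S _ _ _ hexpS σ _ φ ψ n α β γ hreal ι _ a b c hind => ?_⟩
  refine hmain S hexpS σ φ ψ ι (fun i => α (a i, b i)) (fun j => β (b j, c j))
    (fun l => γ (c l, a l)) fun i j l => ?_
  rw [hreal (a i, b i) (b j, c j) (c l, a l)]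
  constructor
  · rintro ⟨h1, h2⟩
    simp only [Prod.mk.injEq] at h2
    exact hind i j l h1 h2.1 h2.2
  · rintro ⟨rfl, rfl⟩
    exact ⟨rfl, rfl⟩

end BoundedExponent

end Summit.MatrixMultiplication.MatrixMultiplication.Theorems.TwistedSliceRank
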